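import Literature.Computability.AlgebraicComplexity.BorderRankCWThm42CertKit
import Literature.Computability.AlgebraicComplexity.BorderRankCWThm42CertData
import HarnessLib

/-!
# CGLV Thm. 4.2 (`bR_S(det₃) ≤ 17`): the kernel-checked certificate of its printed proof and the
# discharge of `CGLV2022_br17RealSolution`

Topic `Literature/Computability/AlgebraicComplexity`. `BorderRankCWThm42.lean` proved the
border-rank half of Conner–Gesmundo–Landsberg–Ventura's Thm. 4.2 (*Rank and border rank of
Kronecker powers of tensors and Strassen's laser method*, comput. complexity 31 (2022) =
arXiv:1909.04785v2) and left its computer-assisted half as the named fact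
`CGLV2022_br17RealSolution` (the system `CGLVBr17System` on the `44` coefficients of the printed
forms `L₁(t), …, L₁₇(t)` has a real solution). Here that fact is DISCHARGED:

* `Br17Cert.cglv_checkDeg_zero/one/two`: the kernel (`decide +kernel`, no `native_decide`, no
  extra axioms) runs the checker `Br17Cert.Cert.checkDeg` of `BorderRankCWThm42CertKit.lean` on
  the certificate `Br17Cert.Cert.ofRaw certR certE certW certMonos` of
  `BorderRankCWThm42CertData.lean`, one `t`-degree at a time (each slice tabulates ≲ 100 cubic
  monomials as elements of `K = ℚ[y]/(p)`; ≈ 400 products of degree-`26` integer polynomials with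
  ≤ 53-digit coefficients in all; three slices keep each kernel run within memory, and
  `maxHeartbeats` is raised for them only);
* `CGLV2022_br17RealSolution_holds` by `Br17Cert.Cert.realSolution` (soundness of the checker +
  a real root of `p` in `[-4, -3]` + real cube roots).

Thm. 4.2 itself (`CGLV2022_thm42`, `bR_S(det₃) ≤ 17`) and Thm. 1.3 are already discharged in
`BorderRankCWCert.lean` through the shorter Conner–Huang–Landsberg certificate; the present file
gives the second, independent proof `CGLV2022_thm42_of_br17RealSolution CGLV2022_br17RealSolution_holds`
along the authors' own decomposition, and settles the named fact recording THEIR computation.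

What is certified, in the words of the source (§5): "the cubes of the values of the monomials …
equal the values of the monomials computed in the `z_α³` inside `K`" and "the equation is
satisfied using exact arithmetic" — here for all `3 · 9³` coordinates of the system as vendored,
in the Kummer form described in `BorderRankCWThm42CertKit.lean` (every `z_j` is an element of `K`
times a monomial in six real cube roots `uᵢ = ∛Wᵢ(y*)`, and each coordinate splits into identities
in `K`, one per class `u^ε`).

## References

* A. Conner, F. Gesmundo, J. M. Landsberg, E. Ventura, *Rank and border rank of Kronecker powers of
  tensors and Strassen's laser method*, comput. complexity 31 (2022) = arXiv:1909.04785v2: Thm. 1.3,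
  Thm. 4.2 and its proof, §5, Supplementary Material Appendix C. [ConnerGesmundoLandsbergVentura2022]
-/

namespace Literature.Computability.AlgebraicComplexity

namespace Br17Cert

-- The three kernel runs below are the certificate check proper; `maxHeartbeats` is raised for
-- them only (each is a single `decide +kernel`, ≈ 1 min of kernel time).

set_option maxHeartbeats 4000000 in
/-- The `t²` component of `∑ᵢ Lᵢ(t)^{⊗3}` is `ε ⊗ ε` at all `9³` coordinates (kernel run).
[cite: ConnerGesmundoLandsbergVentura2022, Thm. 4.2 (proof) and Appendix C] -/
theorem cglv_checkDeg_two : (Cert.ofRaw certR certE certW certMonos).checkDeg 2 = true := by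
  decide +kernel

set_option maxHeartbeats 4000000 in
/-- The `t¹` component of `∑ᵢ Lᵢ(t)^{⊗3}` vanishes at all `9³` coordinates (kernel run).
[cite: ConnerGesmundoLandsbergVentura2022, Thm. 4.2 (proof) and Appendix C] -/
theorem cglv_checkDeg_one : (Cert.ofRaw certR certE certW certMonos).checkDeg 1 = true := by
  decide +kernel

set_option maxHeartbeats 4000000 in
/-- The `t⁰` component of `∑ᵢ Lᵢ(t)^{⊗3}` vanishes at all `9³` coordinates (kernel run).
[cite: ConnerGesmundoLandsbergVentura2022, Thm. 4.2 (proof) and Appendix C] -/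
theorem cglv_checkDeg_zero : (Cert.ofRaw certR certE certW certMonos).checkDeg 0 = true := by
  decide +kernel

/-- All three degree slices of the certificate check pass.
[cite: ConnerGesmundoLandsbergVentura2022, Thm. 4.2 (proof) and Appendix C] -/
theorem cglv_checkDeg (d : ℕ) (hd : d < 3) :
    (Cert.ofRaw certR certE certW certMonos).checkDeg d = true := by
  interval_cases d
  · exact cglv_checkDeg_zero
  · exact cglv_checkDeg_one
  · exact cglv_checkDeg_two

end Br17Cert

/-- **CGLV Thm. 4.2, computer-assisted part — DISCHARGED**: the polynomial system
`CGLVBr17System` of the proof of Thm. 4.2 has a real solution `z ∈ ℝ⁴⁴`, namely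
`z_j = r_j(y*) ∏ᵢ uᵢ^{e_ji}` for the root `y* ∈ [-4, -3]` of `p`, `uᵢ = ∛Wᵢ(y*)`, and the
kernel-checked data of `BorderRankCWThm42CertData.lean`.
[cite: ConnerGesmundoLandsbergVentura2022, Thm. 4.2 (proof) and Appendix C] -/
theorem CGLV2022_br17RealSolution_holds : CGLV2022_br17RealSolution :=
  Br17Cert.Cert.realSolution _ Br17Cert.cglv_checkDeg

end Literature.Computability.AlgebraicComplexity
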